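import Summits.BirchSwinnertonDyer.BirchSwinnertonDyer.Theorems.AlignedTransportAtTwoMainConjectureOfRankZeroBSDAtTwoTwoFixedPointLambdaParity
import HarnessLib

/-!
# Route `AlignedTransportAtTwo`, crux C2 `MainConjectureOfRankZeroBSDAtTwo` (stmt-BirchSwinnertonDyer-22298):
# THE TWO-FIXED-POINTS LEMMA AT `p = 2` (part 3) — the printed multiplier at the second fixed point:
# `(1+T)^e |_{T = −2} = (−1)^{e mod 2}` for every `e ∈ ℤ₂` (S64b, algebraic proof), and the rigidity `λ(L) ≡ e (mod 2)`

HONEST FRAMING (cell `bsd-f1-sign2`, WIDTH-5 attached prover seat `bsd-line-att-p5` gen 33 on line `birth` of the lead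
`bsd-line-att-p2`; `--supports` stmt-BirchSwinnertonDyer-22298, closes nothing; BSD is NOT proved by any of this; the crux C2, its
verdict «blocked-on `Rank1Residual.GreenbergMuConjectureIrreducible`» and every registered stub are untouched). PURE COMMUTATIVE
ALGEBRA over `Λ = ℤ₂⟦T⟧` — THEOREMS ONLY (no `def`, no named fact, no `sorry`). Continuation of `…TwoFixedPointLemma` /
`…TwoFixedPointLambdaParity`.

* §1 `(1 + ι)^e · (1 + T)^e = 1` in `ℤ_p⟦T⟧` for every `p`-adic integer exponent `e` (the tree's field version
  `binomialSeries_subst_invOnePlusSubOne_mul` over `ℚ_p`, transported along the injection `ℤ_p⟦T⟧ ↪ ℚ_p⟦T⟧`).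
* §2 **S64b · `(1+T)^e(−2) = (−1)^{e mod 2}`** (`evalAt_negTwo_binomialSeries`) — ALGEBRAIC proof (the cell's planner-of-record -imc g23
  proved the same statement `EvalAtNegTwoBinomialSeries` in HOME Sketch66 v7 by continuity in `e` and density of `ℕ`; here): with
  `u = (1+T)^e`, `u(T^ι)·u = 1` (§1), `u(T^ι)(−2) = u(−2)` (S64e) so `u(−2)² = 1`, `u(−2) = ±1` (domain); and `u(−2) = 1 − 2e + 4r`
  decides the sign: `u(−2) = 1 ⇒ e = 2r`, `u(−2) = −1 ⇒ e = 1 + 2r`. Restated in the Sketch's binder shape (`evalAtNegTwoBinomialSeries`),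
  so that with S64v (part 1) the Sketch's glue `blindOrderParity_of_fixedPointNegTwoSign` makes K64a `BlindOrderParityAtChi8` a theorem.
* §3 the printed multiplier `v = σ·(1+T)^e`: `v(−2) = σ·(−1)^{e mod 2}`, and the RIGIDITY **`(−1)^{λ(L)} = (−1)^{e mod 2}`** for every
  non-zero `L ∈ ℤ₂⟦T⟧` with `L(T^ι) = σ(1+T)^e·L` (part 2's `v(−2) = (−1)^λ v(0)`): the parity of the exponent of ANY such functional
  equation is forced by `λ` — -imc's D-imc-65 candidate K65p `ExponentParityForcedAtTwo` in its `Λ`-algebra form (for the tree-normalised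
  `2`-adic `L` of an ordinary curve this is PARITY(2) `(−1)^λ = χ₈(N)`, companion `…RoadSecondFixedPoint`).

References: R. Greenberg, LNM 1716 (1999), §1 pp. 67–68, §5 p. 181 [GreenbergLNM1716]; L. Washington, GTM 83, §7.1 [Washington1997].
-/

set_option linter.dupNamespace false
set_option autoImplicit false

noncomputable section

open scoped Classical

namespace Summit.BirchSwinnertonDyer.BirchSwinnertonDyer.Theorems.AlignedTransportAtTwoTwoFixedPoints

open PowerSeries Literature.NumberTheory.EllipticCurves Literature.Barriers.BirchSwinnertonDyer
  Summit.BirchSwinnertonDyer.Rank1Residual.Supersingular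
  Summit.BirchSwinnertonDyer.Rank1Residual.F1Sign2 Summit.BirchSwinnertonDyer.Rank1Residual.X1.MuLambda

/-! ## §1 `(1 + ι)^e · (1 + T)^e = 1` over `ℤ_p` -/

/-- The binomial series with a `p`-adic integer exponent maps to the binomial series over `ℚ_p` (any prime `p`). [folklore] -/
theorem map_algebraMap_binomialSeries {p : ℕ} [Fact p.Prime] (e : ℤ_[p]) :
    PowerSeries.map (algebraMap ℤ_[p] ℚ_[p]) (binomialSeries ℤ_[p] e) = binomialSeries ℚ_[p] e := by
  ext n
  rw [coeff_map, binomialSeries_coeff, binomialSeries_coeff, smul_eq_mul, mul_one, Algebra.smul_def, mul_one]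

/-- **`(1 + T^ι)^e · (1 + T)^e = 1` in `ℤ_p⟦T⟧`** for every `e ∈ ℤ_p` (the tree's `binomialSeries_subst_invOnePlusSubOne_mul` over the field
`ℚ_p`, pulled back along the injective `ℤ_p⟦T⟧ → ℚ_p⟦T⟧`). [folklore] -/
theorem binomialSeries_subst_invOnePlusSubOne_mul_padicInt {p : ℕ} [Fact p.Prime] (e : ℤ_[p]) :
    (binomialSeries ℤ_[p] e).subst (invOnePlusSubOne : PowerSeries ℤ_[p]) * binomialSeries ℤ_[p] e = 1 := by
  apply PowerSeries.map_injective (algebraMap ℤ_[p] ℚ_[p]) (FaithfulSMul.algebraMap_injective ℤ_[p] ℚ_[p])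
  have h1 : PowerSeries.map (algebraMap ℤ_[p] ℚ_[p]) ((binomialSeries ℤ_[p] e).subst (invOnePlusSubOne : PowerSeries ℤ_[p])) =
      (PowerSeries.map (algebraMap ℤ_[p] ℚ_[p]) (binomialSeries ℤ_[p] e)).subst (invOnePlusSubOne : PowerSeries ℚ_[p]) := by
    rw [← map_invOnePlusSubOne (algebraMap ℤ_[p] ℚ_[p])]
    exact PowerSeries.map_subst hasSubst_invOnePlusSubOne _
  rw [map_mul, map_one, h1, map_algebraMap_binomialSeries, binomialSeries_coe_padicInt]
  exact binomialSeries_subst_invOnePlusSubOne_mul (e : ℚ_[p])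

/-! ## §2 S64b: `(1+T)^e` at `T = −2` -/

/-- `toZModPow 1` kills `2`. [folklore] -/
theorem toZModPow_one_two : PadicInt.toZModPow 1 (2 : ℤ_[2]) = 0 := by
  rw [map_ofNat]; decide

/-- **S64b · `(1+T)^e(−2) = (−1)^{e mod 2}` for every `e ∈ ℤ₂`** (`e mod 2` read through `PadicInt.toZModPow 1`, the map in which the
tree's Teichmüller exponent of `N` is given). Algebraic proof: `u(−2)² = 1` by §1 and S64e, and `u(−2) = 1 − 2e + 4r` decides the sign.
(The cell's -imc g23 proved the same statement analytically in HOME Sketch66 v7, `evalAtNegTwoBinomialSeries_holds`.) [folklore] -/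
theorem evalAt_negTwo_binomialSeries (e : ℤ_[2]) :
    BlindLever.evalAt (-2 : ℤ_[2]) (binomialSeries ℤ_[2] e) = (-1 : ℤ_[2]) ^ (PadicInt.toZModPow 1 e).val := by
  set u : PowerSeries ℤ_[2] := binomialSeries ℤ_[2] e with hu
  set a : ℤ_[2] := BlindLever.evalAt (-2 : ℤ_[2]) u with ha
  -- `a² = 1`
  have hsq : a * a = 1 := by
    have h := congrArg (BlindLever.evalAt (-2 : ℤ_[2])) (binomialSeries_subst_invOnePlusSubOne_mul_padicInt e)
    rwa [BlindLever.evalAt_mul BlindLever.norm_neg_two_lt_one, evalAt_negTwo_subst_invOnePlusSubOne,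
      BlindLever.evalAt_one] at h
  -- `a = 1 − 2e + 4r`
  obtain ⟨r, hr⟩ := exists_evalAt_negTwo_eq u
  rw [hu, binomialSeries_constantCoeff, binomialSeries_coeff, Ring.choose_one_right, smul_eq_mul, mul_one, ← hu, ← ha] at hr
  have h2 : (2 : ℤ_[2]) ≠ 0 := by norm_num
  rcases mul_self_eq_one_iff.mp hsq with h1 | h1
  · -- `a = 1`: `e = 2r`
    have he : e = 2 * r := mul_left_cancel₀ h2 (by linear_combination hr - h1)
    rw [h1, he, map_mul, toZModPow_one_two, zero_mul, ZMod.val_zero, pow_zero]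
  · -- `a = −1`: `e = 1 + 2r`
    have he : e = 1 + 2 * r := mul_left_cancel₀ h2 (by linear_combination hr - h1)
    rw [h1, he, map_add, map_one, map_mul, toZModPow_one_two, zero_mul, add_zero]
    have : ((1 : ZMod (2 ^ 1))).val = 1 := by decide
    rw [this, pow_one]

/-- **S64b in the binder shape typed by the planner-of-record** (`EvalAtNegTwoBinomialSeries` of D-imc-64 Sketch66). [folklore] -/
theorem evalAtNegTwoBinomialSeries :
    ∀ x : ℤ_[2],
      BlindLever.evalAt (-2 : ℤ_[2]) (PowerSeries.binomialSeries ℤ_[2] x) = (-1 : ℤ_[2]) ^ (PadicInt.toZModPow 1 x).val :=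
  evalAt_negTwo_binomialSeries

/-! ## §3 The printed multiplier `σ·(1+T)^e` at the second fixed point, and the rigidity `λ ≡ e (mod 2)` -/

/-- `(σ·(1+T)^e)(−2) = σ·(−1)^{e mod 2}`. [folklore] -/
theorem evalAt_negTwo_C_mul_binomialSeries (σ : ℤ_[2]) (e : ℤ_[2]) :
    BlindLever.evalAt (-2 : ℤ_[2]) (C σ * binomialSeries ℤ_[2] e) = σ * (-1 : ℤ_[2]) ^ (PadicInt.toZModPow 1 e).val := by
  rw [BlindLever.evalAt_mul BlindLever.norm_neg_two_lt_one, BlindLever.evalAt_C, evalAt_negTwo_binomialSeries]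

/-- **RIGIDITY `(−1)^{λ(L)} = (−1)^{e mod 2}`**: for every non-zero `L ∈ ℤ₂⟦T⟧` with a functional equation of the printed («diagonal») shape
`L(T^ι) = σ·(1+T)^e·L`, the parity of the exponent is that of `λ(L)` — whatever `σ` (part 2's `v(−2) = (−1)^λ·v(0)` with `v(0) = σ`,
`v(−2) = σ(−1)^{e mod 2}`, `σ = ±1 ≠ 0`). This is -imc's D-imc-65 K65p `ExponentParityForcedAtTwo` in `Λ`-algebra form; for the `2`-adic
`L`-function of an ordinary curve (`e` = exponent of `⟨N⟩`, `(−1)^{e mod 2} = χ₈(N)`) it is PARITY(2). [cite: GreenbergLNM1716, §5 p. 181] -/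
theorem neg_one_pow_lam_eq_neg_one_pow_val_of_subst_eq {L : PowerSeries ℤ_[2]} (hL : L ≠ 0) {σ e : ℤ_[2]}
    (hFE : L.subst (invOnePlusSubOne : PowerSeries ℤ_[2]) = (C σ * binomialSeries ℤ_[2] e) * L) :
    (-1 : ℤ_[2]) ^ lam L = (-1 : ℤ_[2]) ^ (PadicInt.toZModPow 1 e).val := by
  have h := evalAt_negTwo_eq_neg_one_pow_lam_mul_constantCoeff hL hFE
  rw [evalAt_negTwo_C_mul_binomialSeries, map_mul, constantCoeff_C, binomialSeries_constantCoeff, mul_one] at h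
  -- `σ ≠ 0`: it is `(−1)^{ord₀ L}`
  obtain ⟨m, hm⟩ := exists_hasOrderAtZero hL
  have hσ : σ ≠ 0 := by
    have h0 := neg_one_pow_eq_constantCoeff_of_hasOrderAtZero hFE hm
    rw [map_mul, constantCoeff_C, binomialSeries_constantCoeff, mul_one] at h0
    rw [← h0]; exact pow_ne_zero _ (by norm_num)
  have h' : σ * ((-1 : ℤ_[2]) ^ (PadicInt.toZModPow 1 e).val - (-1) ^ lam L) = 0 := by linear_combination h
  rcases mul_eq_zero.mp h' with h'' | h''
  · exact absurd h'' hσ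
  · linear_combination -h''

/-- The same with an integer sign `w` (the shape `C (w : ℤ_[2])` of the tree's curve functional equations). [cite: GreenbergLNM1716, §5 p. 181] -/
theorem neg_one_pow_lam_eq_neg_one_pow_val_of_subst_eq_intCast {L : PowerSeries ℤ_[2]} (hL : L ≠ 0) {w : ℤ} {e : ℤ_[2]}
    (hFE : L.subst (invOnePlusSubOne : PowerSeries ℤ_[2]) = (C ((w : ℤ) : ℤ_[2]) * binomialSeries ℤ_[2] e) * L) :
    (-1 : ℤ) ^ lam L = (-1 : ℤ) ^ (PadicInt.toZModPow 1 e).val := by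
  have h := neg_one_pow_lam_eq_neg_one_pow_val_of_subst_eq hL hFE
  have key : (((-1 : ℤ) ^ lam L : ℤ) : ℤ_[2]) = (((-1 : ℤ) ^ (PadicInt.toZModPow 1 e).val : ℤ) : ℤ_[2]) := by
    push_cast; exact h
  exact Int.cast_injective key

/-- **`(−1)^{ord₋₂ L} = σ·(−1)^{e mod 2}`** for `L(T^ι) = σ(1+T)^e·L` with `L` of order `n` at `T = −2` (S64v + S64b: the K64a mechanism in
`Λ`-algebra form, for any sign and exponent). [cite: GreenbergLNM1716, §5 p. 181] -/
theorem neg_one_pow_orderAtNegTwo_eq_of_subst_eq {L : PowerSeries ℤ_[2]} {σ e : ℤ_[2]} {n : ℕ}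
    (hFE : L.subst (invOnePlusSubOne : PowerSeries ℤ_[2]) = (C σ * binomialSeries ℤ_[2] e) * L) (hn : HasOrderAtNegTwo L n) :
    (-1 : ℤ_[2]) ^ n = σ * (-1 : ℤ_[2]) ^ (PadicInt.toZModPow 1 e).val := by
  rw [neg_one_pow_eq_evalAt_negTwo_of_hasOrderAtNegTwo hFE hn, evalAt_negTwo_C_mul_binomialSeries]

end Summit.BirchSwinnertonDyer.BirchSwinnertonDyer.Theorems.AlignedTransportAtTwoTwoFixedPoints

end
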